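import Summits.AtomisticToContinuum.Crystallization.Theorems.ChargedEnergyGapGrossSurgery
import HarnessLib

/-!
# `ChargedEnergyGap` — GROSS SURGERY, part D: the HARD-CORE LIFT — crowded sites price themselves,
# so the exposed species is priced in EVERY finite injective configuration
# (cell `decomp-a2c`, lens 3, generation 42, node «ExposedTransfer», part D)

Part A (`ChargedEnergyGapGrossSurgery`, generation 41) prices the EXPOSED species (`ε`-rattlers and sites within `R` of an
`ε`-hole) of a finite configuration `y : Fin N → ℝ³` linearly in the excess `E(y) − N·e*`, but only for `1/3`-SEPARATED
`y` (`card_exposed_le_excess_third`): the separation enters solely through the packing count (a `9/10`-ball holds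
`≤ (32/5)³` sites).  The periodic transfer (part C, `ChargedEnergyGapExposedTransfer`) tests the pricing on the BLOCKS
of an arbitrary periodic configuration, which need not be separated.  This file removes the separation hypothesis.

The tree's way of removing hard-core hypotheses — delete a particle of a closest pair, whose site energy is `≥ 729·229/12`
(`CLayerWitnessThinning.exists_le_siteEnergy_of_dist_lt`), and RECOUNT the species with a fixed loss `F` per deletion
(`BarlowRelativePricingRegularise.stub_regularise`, `F = 812` for `1/100`-charges) — does NOT transfer to the exposed
species: a deletion at mutual distance `d → 0` flips `≍ d⁻³` rattlers within `2^{-1/6}` of the deleted point, and every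
hole farther away shallows by up to `1/12` per deletion, cumulatively.  Instead (§9, `card_crowded_le_excess`):

* **crowded sites price themselves.**  Call a site CROWDED if another site lies within `1/3`.  Then
  `#{crowded sites} ≤ E(y) − N·e*` for EVERY injective `y` — by induction on `N`, deleting a particle `i₀` of a closest
  pair (distance `r < 1/3`, `s = r⁻¹ > 3`): its site energy is `≥ s¹²/12 − (250/6)s⁶ ≥ 1 + s³` (shell sum
  `sum_inv_pow_six_le`), the crowded sites that become uncrowded all lie within `1/3` of `y i₀` and are pairwise `≥ r`
  apart, hence number `≤ (2/(3r) + 1)³ ≤ s³` (packing), and `e* ≤ 0` (§8, from the dimer).  No species recount is needed;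

* **isolated exposed sites are priced by part A's surgery** (§10): the packing counts of part A only ever compare two
  COUNTED sites, so `1/3`-isolation of the counted sites (not of `y`) suffices (`card_isoRattlers_le_excess`,
  `card_isoNearHoles_le_excess`, image packing `card_le_of_separated_of_dist_le`);

* hence (§11, `card_exposed_le_excess`) for ALL injective `y`, `ε ≥ 0`, `R ≥ 0`:
  `ε·(#S_r + #S_h) ≤ ((32/5)³ + (6R + 32/5)³ + 2ε)·(E(y) − N·e*)`.

All `[this work]`; ingredients `[folklore]` from the tree as named.
-/

noncomputable section

open scoped BigOperators
open Literature.MathematicalPhysics.StatisticalMechanics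
open Summit.AtomisticToContinuum.Crystallization.Theorems.ChargedEnergyGapNegative
  (E3 eStar card_mul_eStar_le dimer dimer_injective interactionEnergy_dimer)
open Summit.AtomisticToContinuum.Crystallization.Theorems.ChargedPeriodicOptimal
  (exists_separated_net card_le_card_net_mul)

namespace Summit.AtomisticToContinuum.Crystallization.Theorems.ChargedEnergyGapGrossSurgery

variable {N : ℕ}

/-! ## §8 The sign of `e*`: `e* ≤ −1/24 ≤ 0` from the unit dimer (`card_mul_eStar_le`); the tree has this as
`…SummedShellPricing.Negative.eStar_le_neg` / `…UnimodularEnergy.eStar_nonpos` on other import cones, so it is re-derived inline below where used. -/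

/-- The excess `E(y) − N·e*` of an injective configuration is `≥ 0`. -/
theorem excess_nonneg_of_injective {y : Fin N → E3} (hy : Function.Injective y) :
    0 ≤ interactionEnergy lennardJones y - (N : ℝ) * eStar := by
  linarith [card_mul_eStar_le hy]

/-! ## §9 Crowded sites price themselves -/

/-- A site is CROWDED (at scale `1/3`) if another site lies strictly within distance `1/3` of it. [this work] -/
def Crowded (y : Fin N → E3) (i : Fin N) : Prop := ∃ k, k ≠ i ∧ dist (y i) (y k) < 1 / 3

/-- **A particle of a closest pair at distance `r < 1/3` has site energy `≥ 1 + r⁻³`** (indeed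
`≥ r⁻¹²/12 − (250/6)·r⁻⁶`; shell sum `sum_inv_pow_six_le`). -/
theorem le_siteEnergy_of_closest {y : Fin N → E3} (hy : Function.Injective y) {i₀ j₀ : Fin N} (hij₀ : i₀ ≠ j₀)
    (hmin : ∀ a b : Fin N, a ≠ b → dist (y i₀) (y j₀) ≤ dist (y a) (y b)) (hr3 : dist (y i₀) (y j₀) < 1 / 3) :
    1 + (dist (y i₀) (y j₀))⁻¹ ^ 3 ≤ siteEnergy lennardJones y i₀ := by
  set r := dist (y i₀) (y j₀) with hr_def
  have hr : 0 < r := dist_pos.2 (hy.ne hij₀)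
  have hS6 := sum_inv_pow_six_le y hr hmin i₀
  have h12 : r⁻¹ ^ 12 ≤ ∑ a ∈ Finset.univ.erase i₀, (dist (y i₀) (y a))⁻¹ ^ 12 := by
    have hj : j₀ ∈ Finset.univ.erase i₀ := Finset.mem_erase.2 ⟨hij₀.symm, Finset.mem_univ _⟩
    exact Finset.single_le_sum (f := fun a => (dist (y i₀) (y a))⁻¹ ^ 12) (fun a _ => by positivity) hj
  have hexp : siteEnergy lennardJones y i₀ =
      (1 / 12) * ∑ a ∈ Finset.univ.erase i₀, (dist (y i₀) (y a))⁻¹ ^ 12 -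
        (1 / 6) * ∑ a ∈ Finset.univ.erase i₀, (dist (y i₀) (y a))⁻¹ ^ 6 := by
    simp only [siteEnergy, lennardJones, Finset.sum_sub_distrib, Finset.mul_sum]
  set s := r⁻¹ with hs_def
  have hs3 : 3 < s := by
    rw [hs_def, lt_inv_comm₀ (by norm_num) hr]
    have : (3 : ℝ)⁻¹ = 1 / 3 := by norm_num
    linarith
  have hs0 : 0 ≤ s := by linarith
  have hs3' : (27 : ℝ) < s ^ 3 := by
    calc (27 : ℝ) = 3 ^ 3 := by norm_num
      _ < s ^ 3 := pow_lt_pow_left₀ hs3 (by norm_num) (by norm_num)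
  have hs6 : (729 : ℝ) < s ^ 6 := by
    calc (729 : ℝ) = 3 ^ 6 := by norm_num
      _ < s ^ 6 := pow_lt_pow_left₀ hs3 (by norm_num) (by norm_num)
  have hp3 : 0 ≤ s ^ 3 := by positivity
  have hp6 : 0 ≤ s ^ 6 := by positivity
  have h1 : 729 * s ^ 6 ≤ s ^ 12 := by nlinarith [hs6]
  have h2 : 27 * s ^ 3 ≤ s ^ 6 := by nlinarith [hs3']
  rw [hexp]
  linarith [h12, hS6, h1, h2, hs3', hp6]

/-- **Crowded sites price themselves**: in every finite injective configuration the number of crowded sites is at most the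
excess, `#S ≤ E(y) − N·e*` for every set `S` of crowded sites.  Induction on `N` deleting a particle of a closest pair. -/
theorem card_crowded_le_excess : ∀ (N : ℕ) (y : Fin N → E3), Function.Injective y →
    ∀ S : Finset (Fin N), (∀ i ∈ S, Crowded y i) →
      (S.card : ℝ) ≤ interactionEnergy lennardJones y - (N : ℝ) * eStar := by
  intro N
  induction N with
  | zero =>
    intro y hy S _
    have hS0 : S = ∅ := Finset.eq_empty_of_forall_notMem fun i _ => i.elim0
    subst hS0
    simpa using excess_nonneg_of_injective hy
  | succ n ih =>
    intro y hy S hS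
    classical
    rcases S.eq_empty_or_nonempty with hS0 | ⟨i, hi⟩
    · subst hS0; simpa using excess_nonneg_of_injective hy
    obtain ⟨k, hki, hik⟩ := hS i hi
    -- a closest pair `(i₀, j₀)` at distance `r < 1/3`
    obtain ⟨p, hp, hmin⟩ := Finset.exists_min_image Finset.univ.offDiag
      (fun p : Fin (n + 1) × Fin (n + 1) => dist (y p.1) (y p.2)) ⟨(i, k), by simp [hki.symm]⟩
    obtain ⟨i₀, j₀⟩ := p
    have hij₀ : i₀ ≠ j₀ := by simpa using hp
    have hsep : ∀ a b : Fin (n + 1), a ≠ b → dist (y i₀) (y j₀) ≤ dist (y a) (y b) :=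
      fun a b hab => hmin (a, b) (by simp [hab])
    set r := dist (y i₀) (y j₀) with hr_def
    have hr : 0 < r := dist_pos.2 (hy.ne hij₀)
    have hr3 : r < 1 / 3 := (hsep i k hki.symm).trans_lt hik
    have hu : 1 + r⁻¹ ^ 3 ≤ siteEnergy lennardJones y i₀ := le_siteEnergy_of_closest hy hij₀ hsep hr3
    -- delete `i₀`
    have hy' : Function.Injective (y ∘ i₀.succAbove) := hy.comp Fin.succAbove_right_injective
    have hE : interactionEnergy lennardJones y =
        interactionEnergy lennardJones (y ∘ i₀.succAbove) + siteEnergy lennardJones y i₀ :=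
      interactionEnergy_eq_succAbove_add_siteEnergy lennardJones lennardJones_zero y i₀
    -- the crowded sites of the reduced configuration coming from `S`, and the sites near `y i₀`
    set S' : Finset (Fin n) := Finset.univ.filter fun j => i₀.succAbove j ∈ S ∧ Crowded (y ∘ i₀.succAbove) j
      with hS'_def
    set W : Finset (Fin n) := Finset.univ.filter fun j => dist (y (i₀.succAbove j)) (y i₀) < 1 / 3 with hW_def
    have hIH : (S'.card : ℝ) ≤ interactionEnergy lennardJones (y ∘ i₀.succAbove) - (n : ℝ) * eStar :=
      ih (y ∘ i₀.succAbove) hy' S' fun j hj => (Finset.mem_filter.1 hj).2.2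
    -- recount: `S ∖ {i₀} ⊆ succAbove (S' ∪ W)`
    have hsub : S.erase i₀ ⊆ (S' ∪ W).image i₀.succAbove := by
      intro a ha
      obtain ⟨hai₀, haS⟩ := Finset.mem_erase.1 ha
      obtain ⟨j, rfl⟩ := Fin.exists_succAbove_eq hai₀
      refine Finset.mem_image.2 ⟨j, ?_, rfl⟩
      obtain ⟨b, hbj, hjb⟩ := hS _ haS
      by_cases hb : b = i₀
      · subst hb
        exact Finset.mem_union.2 (Or.inr (Finset.mem_filter.2 ⟨Finset.mem_univ _, hjb⟩))
      · obtain ⟨l, rfl⟩ := Fin.exists_succAbove_eq hb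
        have hlj : l ≠ j := fun h => hbj (by rw [h])
        exact Finset.mem_union.2 (Or.inl (Finset.mem_filter.2
          ⟨Finset.mem_univ _, haS, l, hlj, by simpa [Function.comp] using hjb⟩))
    have hcardS : (S.card : ℝ) ≤ 1 + S'.card + W.card := by
      have h1 : S ⊆ insert i₀ ((S' ∪ W).image i₀.succAbove) := Finset.subset_insert_iff.2 hsub
      have h2 : S.card ≤ ((S' ∪ W).image i₀.succAbove).card + 1 :=
        (Finset.card_le_card h1).trans (Finset.card_insert_le _ _)
      have h3 : ((S' ∪ W).image i₀.succAbove).card ≤ S'.card + W.card :=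
        Finset.card_image_le.trans (Finset.card_union_le _ _)
      have : S.card ≤ 1 + S'.card + W.card := by omega
      exact_mod_cast this
    -- the sites near `y i₀` are pairwise `≥ r` apart in a ball of radius `1/3`: at most `(2/(3r) + 1)³ ≤ r⁻³`
    have hW : (W.card : ℝ) ≤ r⁻¹ ^ 3 := by
      have hinj : Set.InjOn (y ∘ i₀.succAbove) W := fun a _ b _ hab => hy' hab
      rw [← Finset.card_image_of_injOn hinj]
      have hpk := card_le_of_separated_of_dist_le (W.image (y ∘ i₀.succAbove)) (y i₀) hr
        (by norm_num : (0 : ℝ) ≤ 1 / 3) ?_ ?_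
      · rw [finrank_euclideanSpace_fin] at hpk
        refine hpk.trans ?_
        have hs3 : 3 ≤ r⁻¹ := by
          rw [le_inv_comm₀ (by norm_num) hr]
          have : (3 : ℝ)⁻¹ = 1 / 3 := by norm_num
          linarith
        have hle : 2 * (1 / 3) / r + 1 ≤ r⁻¹ := by
          rw [div_eq_mul_inv]; linarith
        exact pow_le_pow_left₀ (by positivity) hle 3
      · intro c hc
        obtain ⟨a, ha, rfl⟩ := Finset.mem_image.1 hc
        exact (le_of_lt (Finset.mem_filter.1 ha).2)
      · intro c hc c' hc' hne
        obtain ⟨a, -, rfl⟩ := Finset.mem_image.1 hc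
        obtain ⟨b, -, rfl⟩ := Finset.mem_image.1 hc'
        exact hsep _ _ fun h => hne (by simp [Function.comp, h])
    have he : eStar ≤ 0 := by
      have h := card_mul_eStar_le dimer_injective
      rw [interactionEnergy_dimer] at h
      push_cast at h
      linarith
    push_cast
    linarith [hIH, hcardS, hW, hu, hE, he]

/-! ## §10 Isolated sites: part A's packing counts need isolation of the COUNTED sites only -/

/-- **All isolated rattlers are priced** (finite, injective): if every site of `S` is an `ε`-rattler and no other site
lies within `1/3` of it, then `ε · #S ≤ (32/5)³ · (E(y) − N·e*)`. -/
theorem card_isoRattlers_le_excess {y : Fin N → E3} (hy : Function.Injective y) {ε : ℝ} (S : Finset (Fin N))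
    (hiso : ∀ i ∈ S, ¬ Crowded y i) (hS : ∀ i ∈ S, eStar + ε ≤ siteEnergy lennardJones y i) :
    ε * (S.card : ℝ) ≤ (32 / 5 : ℝ) ^ 3 * (interactionEnergy lennardJones y - (N : ℝ) * eStar) := by
  classical
  have hexc := excess_nonneg_of_injective hy
  have hC : (0 : ℝ) < (32 / 5 : ℝ) ^ 3 := by positivity
  rcases lt_or_ge ε 0 with hε | hε
  · have hS0 : (0 : ℝ) ≤ S.card := Nat.cast_nonneg _
    nlinarith [mul_nonneg hC.le hexc, mul_nonneg hS0 (neg_nonneg.2 hε.le)]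
  have hsep : ∀ i ∈ S, ∀ k, k ≠ i → (1 : ℝ) / 3 ≤ dist (y i) (y k) := by
    intro i hi k hki
    by_contra hlt
    exact hiso i hi ⟨k, hki, not_le.1 hlt⟩
  obtain ⟨T, hTS, hTsep, hnet⟩ := exists_separated_net S y (by norm_num : (0 : ℝ) ≤ 9 / 10)
  have hT : ε * (T.card : ℝ) ≤ interactionEnergy lennardJones y - (N : ℝ) * eStar :=
    card_rattlers_le_excess hy T (fun i hi k hk hik => (hTsep i hi k hk hik).le) fun i hi => hS i (hTS hi)
  have hball : ∀ t ∈ T, ((S.filter fun g => dist (y g) (y t) ≤ 9 / 10).card : ℝ) ≤ (32 / 5 : ℝ) ^ 3 := by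
    intro t _
    set F := S.filter fun g => dist (y g) (y t) ≤ 9 / 10 with hF
    have hinj : Set.InjOn y F := fun k _ l _ hkl => hy hkl
    rw [← Finset.card_image_of_injOn hinj]
    have := card_le_of_separated_of_dist_le (F.image y) (y t) (by norm_num : (0 : ℝ) < 1 / 3)
      (by norm_num : (0 : ℝ) ≤ 9 / 10) ?_ ?_
    · rw [finrank_euclideanSpace_fin] at this
      exact this.trans (by norm_num)
    · intro c hc
      obtain ⟨k, hk, rfl⟩ := Finset.mem_image.1 hc
      exact (Finset.mem_filter.1 hk).2
    · intro c hc c' hc' hne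
      obtain ⟨k, hk, rfl⟩ := Finset.mem_image.1 hc
      obtain ⟨l, -, rfl⟩ := Finset.mem_image.1 hc'
      exact hsep k (Finset.mem_filter.1 hk).1 l fun h => hne (by rw [h])
  have hcount : (S.card : ℝ) ≤ T.card * (32 / 5 : ℝ) ^ 3 := card_le_card_net_mul y hnet hball
  calc ε * (S.card : ℝ) ≤ ε * (T.card * (32 / 5 : ℝ) ^ 3) := mul_le_mul_of_nonneg_left hcount hε
    _ = (32 / 5 : ℝ) ^ 3 * (ε * T.card) := by ring
    _ ≤ _ := mul_le_mul_of_nonneg_left hT hC.le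

/-- **All isolated sites near holes are priced** (finite, injective): if every `i ∈ S` is `1/3`-isolated and has an
`ε`-hole `hole i` of `y` within `R` (field `≤ e* − ε`, all sites `≥ 1/2` away from it), then
`ε · #S ≤ (6R + 32/5)³ · (E(y) − N·e*)`. -/
theorem card_isoNearHoles_le_excess {y : Fin N → E3} (hy : Function.Injective y) {ε R : ℝ} (hR : 0 ≤ R)
    (S : Finset (Fin N)) (hiso : ∀ i ∈ S, ¬ Crowded y i) (hole : Fin N → E3)
    (hnear : ∀ i ∈ S, dist (y i) (hole i) ≤ R) (hfar : ∀ i ∈ S, ∀ k, (1 : ℝ) / 2 ≤ dist (hole i) (y k))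
    (hfield : ∀ i ∈ S, holeField y (hole i) ≤ eStar - ε) :
    ε * (S.card : ℝ) ≤ (6 * R + 32 / 5) ^ 3 * (interactionEnergy lennardJones y - (N : ℝ) * eStar) := by
  classical
  have hexc := excess_nonneg_of_injective hy
  have hC : (0 : ℝ) < (6 * R + 32 / 5) ^ 3 := by positivity
  rcases lt_or_ge ε 0 with hε | hε
  · have hS0 : (0 : ℝ) ≤ S.card := Nat.cast_nonneg _
    nlinarith [mul_nonneg hC.le hexc, mul_nonneg hS0 (neg_nonneg.2 hε.le)]
  have hsep : ∀ i ∈ S, ∀ k, k ≠ i → (1 : ℝ) / 3 ≤ dist (y i) (y k) := by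
    intro i hi k hki
    by_contra hlt
    exact hiso i hi ⟨k, hki, not_le.1 hlt⟩
  obtain ⟨T, hTS, hTsep, hnet⟩ := exists_separated_net S hole (by norm_num : (0 : ℝ) ≤ 9 / 10)
  -- the holes of the net, reindexed by `Fin T.card`, form a `9/10`-separated family off `y`
  set z : Fin T.card → E3 := fun j => hole ((T.equivFin.symm j : T) : Fin N) with hz
  have hmem : ∀ j : Fin T.card, ((T.equivFin.symm j : T) : Fin N) ∈ S := fun j => hTS (T.equivFin.symm j).2
  have hzsep : ∀ j j', j ≠ j' → 9 / 10 ≤ dist (z j) (z j') := by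
    intro j j' hjj
    have hne : ((T.equivFin.symm j : T) : Fin N) ≠ ((T.equivFin.symm j' : T) : Fin N) := fun h =>
      hjj (T.equivFin.symm.injective (Subtype.ext h))
    exact (hTsep _ (T.equivFin.symm j).2 _ (T.equivFin.symm j').2 hne).le
  have hzy : ∀ i j, y i ≠ z j := by
    intro i j h
    have := hfar _ (hmem j) i
    rw [show hole ((T.equivFin.symm j : T) : Fin N) = y i from h.symm, dist_self] at this
    norm_num at this
  have hT : ε * (T.card : ℝ) ≤ interactionEnergy lennardJones y - (N : ℝ) * eStar :=
    card_holes_le_excess hy z hzsep hzy fun j => hfield _ (hmem j)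
  -- counting: `S ⊆ ⋃_{t ∈ T} {g ∈ S : |y g − hole t| ≤ R + 9/10}`, each fibre `1/3`-separated in a ball
  have hsub : S ⊆ T.biUnion fun t => S.filter fun g => dist (y g) (hole t) ≤ R + 9 / 10 := by
    intro g hg
    obtain ⟨t, ht, hgt⟩ := hnet g hg
    refine Finset.mem_biUnion.2 ⟨t, ht, Finset.mem_filter.2 ⟨hg, ?_⟩⟩
    calc dist (y g) (hole t) ≤ dist (y g) (hole g) + dist (hole g) (hole t) := dist_triangle _ _ _
      _ ≤ R + 9 / 10 := add_le_add (hnear g hg) hgt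
  have hfib : ∀ t ∈ T, ((S.filter fun g => dist (y g) (hole t) ≤ R + 9 / 10).card : ℝ) ≤
      (6 * R + 32 / 5) ^ 3 := by
    intro t _
    set F := S.filter fun g => dist (y g) (hole t) ≤ R + 9 / 10 with hF
    have hinj : Set.InjOn y F := fun k _ l _ hkl => hy hkl
    rw [← Finset.card_image_of_injOn hinj]
    have := card_le_of_separated_of_dist_le (F.image y) (hole t) (by norm_num : (0 : ℝ) < 1 / 3)
      (by positivity : (0 : ℝ) ≤ R + 9 / 10) ?_ ?_
    · rw [finrank_euclideanSpace_fin] at this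
      have e2 : (2 * (R + 9 / 10) / (1 / 3 : ℝ) + 1) = 6 * R + 32 / 5 := by ring
      rwa [e2] at this
    · intro c hc
      obtain ⟨k, hk, rfl⟩ := Finset.mem_image.1 hc
      exact (Finset.mem_filter.1 hk).2
    · intro c hc c' hc' hne
      obtain ⟨k, hk, rfl⟩ := Finset.mem_image.1 hc
      obtain ⟨l, -, rfl⟩ := Finset.mem_image.1 hc'
      exact hsep k (Finset.mem_filter.1 hk).1 l fun h => hne (by rw [h])
  have hcount : (S.card : ℝ) ≤ T.card * (6 * R + 32 / 5) ^ 3 :=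
    calc (S.card : ℝ) ≤ ((T.biUnion fun t => S.filter fun g => dist (y g) (hole t) ≤ R + 9 / 10).card : ℝ) := by
          exact_mod_cast Finset.card_le_card hsub
      _ ≤ ∑ t ∈ T, ((S.filter fun g => dist (y g) (hole t) ≤ R + 9 / 10).card : ℝ) := by
          exact_mod_cast Finset.card_biUnion_le
      _ ≤ ∑ _t ∈ T, (6 * R + 32 / 5) ^ 3 := Finset.sum_le_sum hfib
      _ = T.card * (6 * R + 32 / 5) ^ 3 := by rw [Finset.sum_const, nsmul_eq_mul]
  calc ε * (S.card : ℝ) ≤ ε * (T.card * (6 * R + 32 / 5) ^ 3) := mul_le_mul_of_nonneg_left hcount hε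
    _ = (6 * R + 32 / 5) ^ 3 * (ε * T.card) := by ring
    _ = (6 * R + 32 / 5) ^ 3 * (ε * (Fintype.card (Fin T.card) : ℝ)) := by rw [Fintype.card_fin]
    _ ≤ _ := mul_le_mul_of_nonneg_left (by simpa [Fintype.card_fin] using hT) hC.le

/-! ## §11 The exposed species is priced in every finite injective configuration -/

/-- **The exposed species of a finite injective configuration is priced** (no separation hypothesis): with `S_r` a set of
`ε`-rattlers and `S_h` a set of sites within `R` of `ε`-holes (`ε ≥ 0`, `R ≥ 0`),
`ε·(#S_r + #S_h) ≤ ((32/5)³ + (6R + 32/5)³ + 2ε)·(E(y) − N·e*)`: the `1/3`-isolated members by §10, the crowded ones by §9.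
This is the finite form of part B's `ExposedGrossPricing θ ε R` consumed by the periodic transfer (part C). -/
theorem card_exposed_le_excess {y : Fin N → E3} (hy : Function.Injective y) {ε R : ℝ} (hε : 0 ≤ ε) (hR : 0 ≤ R)
    (Sr Sh : Finset (Fin N))
    (hSr : ∀ i ∈ Sr, eStar + ε ≤ siteEnergy lennardJones y i) (hole : Fin N → E3)
    (hnear : ∀ i ∈ Sh, dist (y i) (hole i) ≤ R) (hfar : ∀ i ∈ Sh, ∀ k, (1 : ℝ) / 2 ≤ dist (hole i) (y k))
    (hfield : ∀ i ∈ Sh, holeField y (hole i) ≤ eStar - ε) :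
    ε * ((Sr.card : ℝ) + Sh.card) ≤
      ((32 / 5 : ℝ) ^ 3 + (6 * R + 32 / 5) ^ 3 + 2 * ε) * (interactionEnergy lennardJones y - (N : ℝ) * eStar) := by
  classical
  set X := interactionEnergy lennardJones y - (N : ℝ) * eStar with hX
  have hexc : 0 ≤ X := excess_nonneg_of_injective hy
  -- split each family into its isolated and its crowded part
  set SrI := Sr.filter fun i => ¬ Crowded y i
  set SrC := Sr.filter fun i => Crowded y i
  set ShI := Sh.filter fun i => ¬ Crowded y i
  set ShC := Sh.filter fun i => Crowded y i
  have hr : Sr.card = SrC.card + SrI.card := (Finset.card_filter_add_card_filter_not _).symm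
  have hh : Sh.card = ShC.card + ShI.card := (Finset.card_filter_add_card_filter_not _).symm
  have h1 : ε * (SrI.card : ℝ) ≤ (32 / 5 : ℝ) ^ 3 * X :=
    card_isoRattlers_le_excess hy SrI (fun i hi => (Finset.mem_filter.1 hi).2)
      fun i hi => hSr i (Finset.mem_filter.1 hi).1
  have h2 : ε * (ShI.card : ℝ) ≤ (6 * R + 32 / 5) ^ 3 * X :=
    card_isoNearHoles_le_excess hy hR ShI (fun i hi => (Finset.mem_filter.1 hi).2) hole
      (fun i hi => hnear i (Finset.mem_filter.1 hi).1) (fun i hi => hfar i (Finset.mem_filter.1 hi).1)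
      fun i hi => hfield i (Finset.mem_filter.1 hi).1
  have h3 : (SrC.card : ℝ) ≤ X := card_crowded_le_excess N y hy SrC fun i hi => (Finset.mem_filter.1 hi).2
  have h4 : (ShC.card : ℝ) ≤ X := card_crowded_le_excess N y hy ShC fun i hi => (Finset.mem_filter.1 hi).2
  rw [hr, hh]
  push_cast
  have h3' : ε * (SrC.card : ℝ) ≤ ε * X := mul_le_mul_of_nonneg_left h3 hε
  have h4' : ε * (ShC.card : ℝ) ≤ ε * X := mul_le_mul_of_nonneg_left h4 hε
  nlinarith [h1, h2, h3', h4']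

end Summit.AtomisticToContinuum.Crystallization.Theorems.ChargedEnergyGapGrossSurgery

end
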